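import Summits.SmoothPoincare4.SmoothPoincare4.Theorems.ConvexBisectionAcyclicBisectionExistsStabilisationCurvesFinal
import Summits.SmoothPoincare4.SmoothPoincare4.Theorems.ConvexBisectionAcyclicBisectionExistsSingleOrbitStep
import HarnessLib

/-!
# Node N3a `node_STcurve` from ONE extra charted page curve: the class `±e_1` (Humphries' generator)
(wave 6, brick G6-11 of stub `stub_STgeo` = NF4 N3, line `modp-braid-orbits`, crux
`ConvexBisection.AcyclicBisectionExists`, item stmt-SmoothPoincare4-10508; registered sub-goal
`helper_node_STcurve_of_eOneCurve`)

Twist packages conjugate: packages for `(c, t)`, `(c, ¬t)` and `(a, s)` compose to a package for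
`(T_c^t a, s)` (`twistPackage_conj`; algebra: transvections preserve `stdSymp` and
`T_c^t ∘ T_a^s ∘ T_c^{¬t} = T_{T_c^t a}^s`, `transvection_conj_apply`).  Hence packages propagate along
orbits (`twistPackage_of_orbit`), and by the orbit step `e_j ⤳ −e_{j+1}` of `…SingleOrbitStep.lean`
(`helper_orbit_single_succ`) the packages for all `e_j`, `1 ≤ j < g`, follow from those for the chain
classes (`twistPackage_chainVec`) and for `e_1` alone (`twistPackage_single_all`).  With
`…StabilisationCurvesFinal.lean` this proves the conclusion of `node_STcurve` for every `g`, every unit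
direction `d` and every primitive class from ONE geometric input:

  (R-E1CURVE) for `g ≥ 2`, a charted page curve of `page g 1` (six clauses of node N1a) with shadow
  `e_1` or `−e_1` — the lift to one sheet of a loop in the `x`-plane around the first four branch
  points `ζ_0, ζ_1, ζ_2, ζ_3`

(**`node_STcurve_of_eOneCurve`**, registered `helper_node_STcurve_of_eOneCurve`).  Everything is proved;
no definitions, no named facts, no `sorry`.  Reference: B. Farb, D. Margalit, *A primer on mapping
class groups* (2012), §4.4, Prop. 6.2 [FarbMargalit2012]. [folklore]
-/

noncomputable section

set_option linter.dupNamespace false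

open scoped Manifold ContDiff Topology
open Set Function Metric
open Literature.Topology.FourManifolds Literature.Topology.FourManifolds.LefschetzBase
  Literature.GroupTheory.CombinatorialGroupTheory.SignedHurwitz

namespace Summit.SmoothPoincare4.SmoothPoincare4.Theorems.AcyclicBisectionExists.ModpBraidOrbits

variable {g : ℕ}

/-! ## §1 Conjugation of transvections -/

/-- **Transvections are symplectic** for `stdSymp ℤ g`. [folklore] -/
theorem stdSymp_transvection_transvection (c : Fin g ⊕ Fin g → ℤ) (t : Bool) (u v : Fin g ⊕ Fin g → ℤ) :
    stdSymp ℤ g (transvection (stdSymp ℤ g) (c, t) u) (transvection (stdSymp ℤ g) (c, t) v) = stdSymp ℤ g u v := by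
  rw [transvection_apply, transvection_apply]
  dsimp only
  simp only [map_add, map_smul, LinearMap.add_apply, LinearMap.smul_apply, smul_eq_mul, stdSymp_int_self,
    mul_zero, add_zero]
  rw [stdSymp_int_swap g u c]
  ring

/-- **Conjugation**: `T_c^t (T_a^s (T_c^{¬t} x)) = T_{T_c^t a}^s x`. [folklore] -/
theorem transvection_conj_apply (c a : Fin g ⊕ Fin g → ℤ) (t s : Bool) (x : Fin g ⊕ Fin g → ℤ) :
    transvection (stdSymp ℤ g) (c, t) (transvection (stdSymp ℤ g) (a, s) (transvection (stdSymp ℤ g) (c, !t) x)) =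
      transvection (stdSymp ℤ g) (transvection (stdSymp ℤ g) (c, t) a, s) x := by
  have hinv := transvection_transvection_not (stdSymp ℤ g) (c, t) (stdSymp_int_self g c) x
  have hB : stdSymp ℤ g a (transvection (stdSymp ℤ g) (c, !t) x) =
      stdSymp ℤ g (transvection (stdSymp ℤ g) (c, t) a) x := by
    rw [← stdSymp_transvection_transvection c t a (transvection (stdSymp ℤ g) (c, !t) x)]
    exact congrArg _ hinv
  rw [transvection_apply (x := (a, s)), map_add, map_smul, transvection_apply (x := (transvection (stdSymp ℤ g) (c, t) a, s))]
  dsimp only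
  rw [hB]
  exact congrArg (· + _) hinv

/-! ## §2 Conjugation of twist packages; packages along orbits -/

/-- **Conjugation of twist packages** (on `page g 1`): packages for `(c, t)`, `(c, ¬t)` and `(a, s)`
give a package for `(T_c^t a, s)` — the composite `τ_c ∘ τ_a ∘ τ_c'`. [cite: FarbMargalit2012, §4.4] -/
theorem twistPackage_conj (c a : Fin g ⊕ Fin g → ℤ) (t s : Bool)
    (hc : ∃ (τ : Base g → Base g) (hτ : Continuous τ), (∀ p ∈ page g 1, τ p ∈ page g 1) ∧
      (∀ K : Metric.sphere (0 : EuclideanSpace ℝ (Fin 2)) 1 → Base g,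
        Manifold.IsSmoothEmbedding (𝓡 1) (𝓡∂ 4) ∞ K → (∀ θ, K θ ∈ page g 1) →
        Manifold.IsSmoothEmbedding (𝓡 1) (𝓡∂ 4) ∞ (τ ∘ K)) ∧
      (∀ (K : Metric.sphere (0 : EuclideanSpace ℝ (Fin 2)) 1 → Base g) (hK : Continuous K),
        (∀ θ, K θ ∈ page g 1) →
        shadow g (τ ∘ K) (hτ.comp hK) = transvection (stdSymp ℤ g) (c, t) (shadow g K hK)))
    (hc' : ∃ (τ : Base g → Base g) (hτ : Continuous τ), (∀ p ∈ page g 1, τ p ∈ page g 1) ∧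
      (∀ K : Metric.sphere (0 : EuclideanSpace ℝ (Fin 2)) 1 → Base g,
        Manifold.IsSmoothEmbedding (𝓡 1) (𝓡∂ 4) ∞ K → (∀ θ, K θ ∈ page g 1) →
        Manifold.IsSmoothEmbedding (𝓡 1) (𝓡∂ 4) ∞ (τ ∘ K)) ∧
      (∀ (K : Metric.sphere (0 : EuclideanSpace ℝ (Fin 2)) 1 → Base g) (hK : Continuous K),
        (∀ θ, K θ ∈ page g 1) →
        shadow g (τ ∘ K) (hτ.comp hK) = transvection (stdSymp ℤ g) (c, !t) (shadow g K hK)))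
    (ha : ∃ (τ : Base g → Base g) (hτ : Continuous τ), (∀ p ∈ page g 1, τ p ∈ page g 1) ∧
      (∀ K : Metric.sphere (0 : EuclideanSpace ℝ (Fin 2)) 1 → Base g,
        Manifold.IsSmoothEmbedding (𝓡 1) (𝓡∂ 4) ∞ K → (∀ θ, K θ ∈ page g 1) →
        Manifold.IsSmoothEmbedding (𝓡 1) (𝓡∂ 4) ∞ (τ ∘ K)) ∧
      (∀ (K : Metric.sphere (0 : EuclideanSpace ℝ (Fin 2)) 1 → Base g) (hK : Continuous K),
        (∀ θ, K θ ∈ page g 1) →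
        shadow g (τ ∘ K) (hτ.comp hK) = transvection (stdSymp ℤ g) (a, s) (shadow g K hK))) :
    ∃ (τ : Base g → Base g) (hτ : Continuous τ), (∀ p ∈ page g 1, τ p ∈ page g 1) ∧
      (∀ K : Metric.sphere (0 : EuclideanSpace ℝ (Fin 2)) 1 → Base g,
        Manifold.IsSmoothEmbedding (𝓡 1) (𝓡∂ 4) ∞ K → (∀ θ, K θ ∈ page g 1) →
        Manifold.IsSmoothEmbedding (𝓡 1) (𝓡∂ 4) ∞ (τ ∘ K)) ∧
      (∀ (K : Metric.sphere (0 : EuclideanSpace ℝ (Fin 2)) 1 → Base g) (hK : Continuous K),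
        (∀ θ, K θ ∈ page g 1) →
        shadow g (τ ∘ K) (hτ.comp hK) =
          transvection (stdSymp ℤ g) (transvection (stdSymp ℤ g) (c, t) a, s) (shadow g K hK)) := by
  obtain ⟨τc, hτc, pc, ec, sc⟩ := hc
  obtain ⟨τc', hτc', pc', ec', sc'⟩ := hc'
  obtain ⟨τa, hτa, pa, ea, sa⟩ := ha
  refine ⟨τc ∘ τa ∘ τc', hτc.comp (hτa.comp hτc'), fun p hp => pc _ (pa _ (pc' _ hp)),
    fun K hKe hKp => ?_, fun K hK hKp => ?_⟩
  · have h1 := ec' K hKe hKp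
    have h2 := ea (τc' ∘ K) h1 (fun θ => pc' _ (hKp θ))
    exact ec (τa ∘ (τc' ∘ K)) h2 (fun θ => pa _ (pc' _ (hKp θ)))
  · have hp1 : ∀ θ, (τc' ∘ K) θ ∈ page g 1 := fun θ => pc' _ (hKp θ)
    have hp2 : ∀ θ, (τa ∘ (τc' ∘ K)) θ ∈ page g 1 := fun θ => pa _ (hp1 θ)
    have h1 := sc' K hK hKp
    have h2 := sa (τc' ∘ K) (hτc'.comp hK) hp1
    have h3 := sc (τa ∘ (τc' ∘ K)) (hτa.comp (hτc'.comp hK)) hp2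
    rw [h2, h1, transvection_conj_apply] at h3
    exact h3

/-- **Packages propagate along orbits**: if all generator classes (chain vectors and `e_{j'}`, `j' ≤ j`)
have packages of both signs and `x` has packages of both signs, so does every `y` in the orbit of `x`.
[cite: FarbMargalit2012, §4.4] -/
theorem twistPackage_of_orbit (j : ℕ) {x y : Fin g ⊕ Fin g → ℤ}
    (hxy : Relation.ReflTransGen (fun x y : Fin g ⊕ Fin g → ℤ =>
      ∃ (a : Fin g ⊕ Fin g → ℤ) (s : Bool), ((∃ m : ℕ, m < 2 * g ∧ a = chainVec g m) ∨
        (∃ j' : Fin g, (j' : ℕ) ≤ j ∧ a = Pi.single (Sum.inl j') 1)) ∧ y = transvection (stdSymp ℤ g) (a, s) x) x y)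
    (hgen : ∀ (a : Fin g ⊕ Fin g → ℤ), ((∃ m : ℕ, m < 2 * g ∧ a = chainVec g m) ∨
        (∃ j' : Fin g, (j' : ℕ) ≤ j ∧ a = Pi.single (Sum.inl j') 1)) → ∀ t : Bool,
      ∃ (τ : Base g → Base g) (hτ : Continuous τ), (∀ p ∈ page g 1, τ p ∈ page g 1) ∧
        (∀ K : Metric.sphere (0 : EuclideanSpace ℝ (Fin 2)) 1 → Base g,
          Manifold.IsSmoothEmbedding (𝓡 1) (𝓡∂ 4) ∞ K → (∀ θ, K θ ∈ page g 1) →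
          Manifold.IsSmoothEmbedding (𝓡 1) (𝓡∂ 4) ∞ (τ ∘ K)) ∧
        (∀ (K : Metric.sphere (0 : EuclideanSpace ℝ (Fin 2)) 1 → Base g) (hK : Continuous K),
          (∀ θ, K θ ∈ page g 1) →
          shadow g (τ ∘ K) (hτ.comp hK) = transvection (stdSymp ℤ g) (a, t) (shadow g K hK)))
    (hx : ∀ s : Bool, ∃ (τ : Base g → Base g) (hτ : Continuous τ), (∀ p ∈ page g 1, τ p ∈ page g 1) ∧
        (∀ K : Metric.sphere (0 : EuclideanSpace ℝ (Fin 2)) 1 → Base g,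
          Manifold.IsSmoothEmbedding (𝓡 1) (𝓡∂ 4) ∞ K → (∀ θ, K θ ∈ page g 1) →
          Manifold.IsSmoothEmbedding (𝓡 1) (𝓡∂ 4) ∞ (τ ∘ K)) ∧
        (∀ (K : Metric.sphere (0 : EuclideanSpace ℝ (Fin 2)) 1 → Base g) (hK : Continuous K),
          (∀ θ, K θ ∈ page g 1) →
          shadow g (τ ∘ K) (hτ.comp hK) = transvection (stdSymp ℤ g) (x, s) (shadow g K hK)))
    (s : Bool) :
    ∃ (τ : Base g → Base g) (hτ : Continuous τ), (∀ p ∈ page g 1, τ p ∈ page g 1) ∧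
      (∀ K : Metric.sphere (0 : EuclideanSpace ℝ (Fin 2)) 1 → Base g,
        Manifold.IsSmoothEmbedding (𝓡 1) (𝓡∂ 4) ∞ K → (∀ θ, K θ ∈ page g 1) →
        Manifold.IsSmoothEmbedding (𝓡 1) (𝓡∂ 4) ∞ (τ ∘ K)) ∧
      (∀ (K : Metric.sphere (0 : EuclideanSpace ℝ (Fin 2)) 1 → Base g) (hK : Continuous K),
        (∀ θ, K θ ∈ page g 1) →
        shadow g (τ ∘ K) (hτ.comp hK) = transvection (stdSymp ℤ g) (y, s) (shadow g K hK)) := by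
  induction hxy generalizing s with
  | refl => exact hx s
  | tail _ hst ih =>
    obtain ⟨c, t, hcg, rfl⟩ := hst
    have h := twistPackage_conj c _ t s (hgen c hcg t) (hgen c hcg (!t)) (ih s)
    exact h

/-! ## §3 Packages for all `e_j` from the chain and `e_1` -/

/-- **Packages for all `e_j`, `1 ≤ j < g`, from packages for the chain classes and for `e_1`** (strong
induction on `j` along the orbit steps `e_j ⤳ −e_{j+1}`; `T_{−a} = T_a`). [cite: FarbMargalit2012, §4.4] -/
theorem twistPackage_single_all (hg : 2 ≤ g)
    (h1 : ∀ t : Bool, ∃ (τ : Base g → Base g) (hτ : Continuous τ), (∀ p ∈ page g 1, τ p ∈ page g 1) ∧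
        (∀ K : Metric.sphere (0 : EuclideanSpace ℝ (Fin 2)) 1 → Base g,
          Manifold.IsSmoothEmbedding (𝓡 1) (𝓡∂ 4) ∞ K → (∀ θ, K θ ∈ page g 1) →
          Manifold.IsSmoothEmbedding (𝓡 1) (𝓡∂ 4) ∞ (τ ∘ K)) ∧
        (∀ (K : Metric.sphere (0 : EuclideanSpace ℝ (Fin 2)) 1 → Base g) (hK : Continuous K),
          (∀ θ, K θ ∈ page g 1) →
          shadow g (τ ∘ K) (hτ.comp hK) =
            transvection (stdSymp ℤ g) (Pi.single (Sum.inl (⟨1, hg⟩ : Fin g)) 1, t) (shadow g K hK))) :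
    ∀ (n : ℕ) (j : Fin g), (j : ℕ) = n → 1 ≤ n → ∀ t : Bool,
      ∃ (τ : Base g → Base g) (hτ : Continuous τ), (∀ p ∈ page g 1, τ p ∈ page g 1) ∧
        (∀ K : Metric.sphere (0 : EuclideanSpace ℝ (Fin 2)) 1 → Base g,
          Manifold.IsSmoothEmbedding (𝓡 1) (𝓡∂ 4) ∞ K → (∀ θ, K θ ∈ page g 1) →
          Manifold.IsSmoothEmbedding (𝓡 1) (𝓡∂ 4) ∞ (τ ∘ K)) ∧
        (∀ (K : Metric.sphere (0 : EuclideanSpace ℝ (Fin 2)) 1 → Base g) (hK : Continuous K),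
          (∀ θ, K θ ∈ page g 1) →
          shadow g (τ ∘ K) (hτ.comp hK) = transvection (stdSymp ℤ g) (Pi.single (Sum.inl j) 1, t) (shadow g K hK)) := by
  intro n
  induction n using Nat.strong_induction_on with
  | _ n ih =>
  intro j hjn hn t
  rcases Nat.lt_or_ge n 2 with hlt | hge
  · -- `j = 1`
    have hj1 : j = ⟨1, hg⟩ := Fin.ext (by rw [hjn]; show n = 1; omega)
    rw [hj1]; exact h1 t
  · -- `j = m + 1` with `1 ≤ m`: the orbit step from `e_m`
    obtain ⟨m, rfl⟩ : ∃ m, n = m + 1 := ⟨n - 1, by omega⟩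
    have hjg := j.2
    have horb := orbit_single_succ (g := g) (j := m) (by omega) (by omega)
    have hgen : ∀ (a : Fin g ⊕ Fin g → ℤ), ((∃ m' : ℕ, m' < 2 * g ∧ a = chainVec g m') ∨
        (∃ j' : Fin g, (j' : ℕ) ≤ m ∧ a = Pi.single (Sum.inl j') 1)) → ∀ t : Bool,
        ∃ (τ : Base g → Base g) (hτ : Continuous τ), (∀ p ∈ page g 1, τ p ∈ page g 1) ∧
          (∀ K : Metric.sphere (0 : EuclideanSpace ℝ (Fin 2)) 1 → Base g,
            Manifold.IsSmoothEmbedding (𝓡 1) (𝓡∂ 4) ∞ K → (∀ θ, K θ ∈ page g 1) →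
            Manifold.IsSmoothEmbedding (𝓡 1) (𝓡∂ 4) ∞ (τ ∘ K)) ∧
          (∀ (K : Metric.sphere (0 : EuclideanSpace ℝ (Fin 2)) 1 → Base g) (hK : Continuous K),
            (∀ θ, K θ ∈ page g 1) →
            shadow g (τ ∘ K) (hτ.comp hK) = transvection (stdSymp ℤ g) (a, t) (shadow g K hK)) := by
      rintro a (⟨m', hm', rfl⟩ | ⟨j', hj', rfl⟩) t'
      · exact twistPackage_chainVec g hm' t'
      · by_cases hj'0 : (j' : ℕ) = 0
        · have hg1 : 1 ≤ g := by omega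
          have hj'e : j' = ⟨0, hg1⟩ := Fin.ext hj'0
          rw [hj'e, ← chainVec_zero_eq_single hg1]
          exact twistPackage_chainVec g (by omega) t'
        · exact ih j' (by omega) j' rfl (by omega) t'
    have hstart := ih m (by omega) ⟨m, by omega⟩ rfl (by omega)
    have h := twistPackage_of_orbit m horb hgen hstart t
    have hje : (⟨m + 1, by omega⟩ : Fin g) = j := Fin.ext (by rw [hjn])
    obtain ⟨τ, hτ, p1, p2, p3⟩ := h
    refine ⟨τ, hτ, p1, p2, fun K hK hKp => ?_⟩
    rw [p3 K hK hKp, transvection_neg_eq, hje]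

/-! ## §4 N3a from one extra charted curve -/

/-- **Node N3a from ONE extra charted page curve of class `±e_1`.**  If (for `g ≥ 2`) some charted page
curve of `page g 1` has shadow `e_1` or `−e_1`, then every primitive class of `ℤ^{2g}` is the shadow of
a smoothly embedded curve of every flat open page `page g d`, `‖d‖ = 1`.
[cite: FarbMargalit2012, Prop. 6.2] -/
theorem node_STcurve_of_eOneCurve (g : ℕ)
    (hE : ∀ hg : 2 ≤ g, ∃ (φ : ℝ × ℝ → Base g) (b : Metric.sphere (0 : EuclideanSpace ℝ (Fin 2)) 1 → Base g)
        (hb : Continuous b), ContMDiff 𝓘(ℝ, ℝ × ℝ) (𝓡∂ 4) ∞ φ ∧ (∀ u r, φ (u + 1, r) = φ (u, r)) ∧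
        (∀ u, φ (u, 0) = b (circlePt u)) ∧ (∀ p, φ p ∈ page g 1) ∧
        InjOn φ (Ico (0 : ℝ) 1 ×ˢ Ioo (-1 : ℝ) 1) ∧
        (∀ u r, r ∈ Ioo (-1 : ℝ) 1 →
          0 < inner ℝ (deriv (fun r' => (φ (u, r')).1) r) (cplxJ (deriv (fun u' => (φ (u', r)).1) u))) ∧
        (shadow g b hb = Pi.single (Sum.inl (⟨1, hg⟩ : Fin g)) 1 ∨
          shadow g b hb = -Pi.single (Sum.inl (⟨1, hg⟩ : Fin g)) 1))
    {d : ℂ} (hd : ‖d‖ = 1) (v : Fin g ⊕ Fin g → ℤ) (hv : IsPrimitive v) :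
    ∃ K : Metric.sphere (0 : EuclideanSpace ℝ (Fin 2)) 1 → Base g,
      Manifold.IsSmoothEmbedding (𝓡 1) (𝓡∂ 4) ∞ K ∧ (∀ θ, K θ ∈ page g d) ∧
      ∃ hK : Continuous K, shadow g K hK = v := by
  rcases Nat.lt_or_ge g 2 with hlt | hg
  · -- `g ≤ 1`: no `e_j` with `j ≥ 1`
    exact node_STcurve_of_eCurves g (fun j hj => absurd hj (by have := j.2; omega)) hd v hv
  · obtain ⟨φ, b, hb, h1, h2, h3, h4, h5, h6, hsh⟩ := hE hg
    have hpk1 : ∀ t : Bool, _ := fun t => twistPackage_of_chart_neg g t φ b hb h1 h2 h3 h4 h5 h6 _ hsh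
    have hall := twistPackage_single_all hg hpk1
    refine stcurve_of_page_one g (stcurve_of_twists g 1 (fun a s ha => ?_) (exists_embedded_baseCurve (by omega)))
      hd v hv
    rcases ha with ⟨i, hi, rfl⟩ | ⟨j, rfl⟩
    · exact twistPackage_chainVec g hi s
    · by_cases hj : 1 ≤ (j : ℕ)
      · exact hall j j rfl hj s
      · have hg1 : 1 ≤ g := by omega
        have hj0 : j = ⟨0, hg1⟩ := Fin.ext (by push Not at hj; show (j : ℕ) = 0; omega)
        rw [hj0, ← chainVec_zero_eq_single hg1]
        exact twistPackage_chainVec g (by omega) s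

/-! ## The registered form -/

/-- **Sub-goal `helper_node_STcurve_of_eOneCurve`** (G6-11, node N3a `node_STcurve` from ONE geometric
input): a charted page curve of `page g 1` with shadow `±e_1` (needed only for `g ≥ 2`) gives a smoothly
embedded curve in every flat open page `page g d` (`‖d‖ = 1`) in every primitive class.
[cite: FarbMargalit2012, Prop. 6.2] -/
theorem helper_node_STcurve_of_eOneCurve : ∀ (g : ℕ), (∀ hg : 2 ≤ g, ∃ (φ : ℝ × ℝ → Literature.Topology.FourManifolds.LefschetzBase.Base g) (b : Metric.sphere (0 : EuclideanSpace ℝ (Fin 2)) 1 → Literature.Topology.FourManifolds.LefschetzBase.Base g) (hb : Continuous b), ContMDiff 𝓘(ℝ, ℝ × ℝ) (𝓡∂ 4) ∞ φ ∧ (∀ u r, φ (u + 1, r) = φ (u, r)) ∧ (∀ u, φ (u, 0) = b (Literature.Topology.FourManifolds.circlePt u)) ∧ (∀ p, φ p ∈ Literature.Topology.FourManifolds.LefschetzBase.page g 1) ∧ Set.InjOn φ (Set.Ico (0 : ℝ) 1 ×ˢ Set.Ioo (-1 : ℝ) 1) ∧ (∀ u r, r ∈ Set.Ioo (-1 : ℝ)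 1 → 0 < inner ℝ (deriv (fun r' => (φ (u, r')).1) r) (Literature.Topology.FourManifolds.LefschetzBase.cplxJ (deriv (fun u' => (φ (u', r)).1) u))) ∧ (Literature.Topology.FourManifolds.LefschetzBase.shadow g b hb = Pi.single (Sum.inl (⟨1, hg⟩ : Fin g)) 1 ∨ Literature.Topology.FourManifolds.LefschetzBase.shadow g b hb = -Pi.single (Sum.inl (⟨1, hg⟩ : Fin g)) 1)) → ∀ (d : ℂ), ‖d‖ = 1 → ∀ (v : Fin g ⊕ Fin g → ℤ), Literature.GroupTheory.CombinatorialGroupTheory.SignedHurwitz.IsPrimitive v → ∃ K : Metric.sphere (0 : EuclideanSpace ℝ (Fin 2)) 1 → Literature.Topology.FourManifolds.LefschetzBase.Base g, Manifold.IsSmoothEmbedding (𝓡 1) (𝓡∂ 4) ∞ K ∧ (∀ θ, K θ ∈ Literature.Topology.FourManifolds.LefschetzBase.page g d) ∧ ∃ hK : Continuous K, Literature.Topology.FourManifolds.LefschetzBase.shadow g K hK = v :=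
  fun g hE _ hd v hv => node_STcurve_of_eOneCurve g hE hd v hv

end Summit.SmoothPoincare4.SmoothPoincare4.Theorems.AcyclicBisectionExists.ModpBraidOrbits

end
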